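import Mathlib
import Summits.ValiantsHypothesis.ValiantsHypothesis.Theorems.FifoMatchingNNDivisionHardGrandResidualArcsDim
import Summits.ValiantsHypothesis.ValiantsHypothesis.Theorems.FifoMatchingNNDivisionHardFaceNewtonDimension
import HarnessLib

/-!
# Route FifoMatching — crux `NNDivisionHard` (stmt-ValiantsHypothesis-21181): the GRAND RESIDUAL ∧ BOUNDED-ARC-SET
# NON-GENERIC ∧ HIGH NEWTON DIMENSION ∧ HIGH FIBRE DIMENSION ON EVERY PRODUCT FACE — one residual of record, by name

`…GrandResidualArcsDim.nnDivisionHard_iff_grandResidualArcsDim` (✓ p833758) and the general product-face form of the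
Newton-dimension descent `…FaceNewtonDimension.faceNewtonDim_not_certificate_qp` (✓ p834188): for every product face
`top_w NN_n = ι(NN_b) · S` (`ι` an injective renaming of the arcs of `[0,2b)`, `S ≠ 0` off `range ι`) a certificate's `w`-initial
form has, pulled back along `ι`, Newton dimension `D` with `b < 2 (D + 1) ((log₂ n + c + 19)^{6(c+19)} + 3)`.  As before the new
conjunct intersects for free:

* ★ BY NAME `nnDivisionHard_iff_grandResidualFibreDim` — **`Theses.FifoMatching.NNDivisionHard` ⟺ for all `k c`, eventually in
  `n`, every `h ≠ 0` that is cheap, torus-homogeneous, window-dense, deep, spread, undominated, non-generic for every arc set of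
  size `≤ k`, of high Newton dimension, AND OF HIGH FIBRE DIMENSION ON EVERY PRODUCT FACE (for all `b ≤ n`, injective `ι`,
  `w`, `S` with `top_w NN_n = ι(NN_b) · S`, `S ≠ 0` off `range ι`: `b < 2 (D_{ι,w}(h) + 1) ((log₂ n + c + 19)^{6(c+19)} + 3)`,
  `D_{ι,w}(h) = dim aff {u ∘ ι : u ∈ supp (top_w h)}`) satisfies `2^((log₂ n + c)^c) < L₊(NN_n · h) + L₊(h)`.**

HONEST FRAMING: residual book-keeping BY NAME; `NNDivisionHard`, `NNNotVP`, VP ≠ VNP stay OPEN (NOT proved).  No definitions,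
no named facts.  References: Hrubeš–Yehudayoff 2021 §6 Problem 2 [HrubesYehudayoff2021]; Bürgisser 2000 Rem. 2.7 [Burgisser2000].
-/

noncomputable section

-- Sub = Summit single-conjunct layout: the duplicated namespace component is mandated by the tree.
set_option linter.dupNamespace false
set_option autoImplicit false

namespace Summit.ValiantsHypothesis.ValiantsHypothesis.Theorems.FifoMatching.NNDivisionHard.GrandResidualFibreDim

open MvPolynomial Finset Literature.Computability.AlgebraicComplexity
open scoped NNReal BigOperators Classical
open Summit.ValiantsHypothesis.ValiantsHypothesis.Theorems.ZeroOneTransfer.Negative (topComponent)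
open Summit.ValiantsHypothesis.ValiantsHypothesis.Theorems.FifoMatching.NNLowDegreeCofactorHard (vertexDeg)
open Summit.ValiantsHypothesis.ValiantsHypothesis.Theorems.FifoMatching.NNNotVP.DivisionSplit (σ NN SuppFn freeVars)
open Summit.ValiantsHypothesis.ValiantsHypothesis.Theorems.FifoMatching.NNDivisionHard.GrandResidualArcsDim
  (nnDivisionHard_iff_grandResidualArcsDim)
open Summit.ValiantsHypothesis.ValiantsHypothesis.Theorems.FifoMatching.NNDivisionHard.FaceNewtonDimension
  (faceNewtonDim_not_certificate_qp)

/-- ★ **BY NAME: `NNDivisionHard` ⟺ grand residual ∧ bounded-arc-set non-generic ∧ high Newton dimension ∧ high fibre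
dimension on every product face.** [cite: HrubesYehudayoff2021, §6 Problem 2] -/
theorem nnDivisionHard_iff_grandResidualFibreDim :
    Summit.ValiantsHypothesis.ValiantsHypothesis.Theses.FifoMatching.NNDivisionHard ↔
      ∀ k c : ℕ, ∃ n₀ : ℕ, ∀ n ≥ n₀, ∀ h : MvPolynomial (Fin (2 * n) × Fin (2 * n)) ℝ≥0, h ≠ 0 →
        complexity h ≤ 2 ^ ((Nat.log 2 n + c) ^ c) →
        (∀ d ∈ h.support, ∀ d' ∈ h.support, vertexDeg d = vertexDeg d') →
        (∀ d ∈ h.support, ∀ s : ℕ,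
          s + (2 * ((Nat.log 2 n + c) ^ c + Nat.log 2 n + 1) ^ 6 + 12) ≤ 2 * n →
          ∃ e ∈ d.support,
            (s ≤ e.1.val ∧ e.1.val < s + (2 * ((Nat.log 2 n + c) ^ c + Nat.log 2 n + 1) ^ 6 + 12)) ∨
            (s ≤ e.2.val ∧ e.2.val < s + (2 * ((Nat.log 2 n + c) ^ c + Nat.log 2 n + 1) ^ 6 + 12))) →
        (∀ e : ℕ, e ≤ 2 ^ ((Nat.log 2 n + k) ^ k) → homogeneousComponent e h = 0) →
        (∀ d ∈ h.support, (Nat.log 2 n + k) ^ k < d.support.card) →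
        (∀ T : Finset (σ n), T.card ≤ (Nat.log 2 n + k) ^ k →
          ∃ A : Finset (σ n), SuppFn (freeVars T (NN n)) A ∧ ¬ SuppFn (freeVars T h) A) →
        (∀ I : Finset (Fin (2 * n) × Fin (2 * n)), I.card ≤ k →
          ∀ (d : (Fin (2 * n) × Fin (2 * n)) →₀ ℕ) (a : ℝ≥0), a ≠ 0 →
            topComponent (fun v : Fin (2 * n) × Fin (2 * n) => if v ∈ I then 0 else 1) h ≠ monomial d a) →
        n < (Module.finrank ℚ (vectorSpan ℚ ((fun u : (Fin (2 * n) × Fin (2 * n)) →₀ ℕ =>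
          fun a : Fin (2 * n) × Fin (2 * n) => (u a : ℚ)) '' (h.support : Set ((Fin (2 * n) × Fin (2 * n)) →₀ ℕ))))
          + 1) ^ 2 →
        (∀ b : ℕ, b ≤ n → ∀ (ι : Fin (2 * b) × Fin (2 * b) → Fin (2 * n) × Fin (2 * n)), Function.Injective ι →
          ∀ (w : Fin (2 * n) × Fin (2 * n) → ℕ) (S : MvPolynomial (Fin (2 * n) × Fin (2 * n)) ℝ≥0),
            topComponent w (nestFreeMatchingPoly n ℝ≥0) = rename ι (nestFreeMatchingPoly b ℝ≥0) * S → S ≠ 0 →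
            (∀ m ∈ S.support, ∀ e ∈ m.support, e ∉ Set.range ι) →
            b < 2 * (Module.finrank ℚ (vectorSpan ℚ ((fun u : (Fin (2 * n) × Fin (2 * n)) →₀ ℕ =>
              fun t : Fin (2 * b) × Fin (2 * b) => (u (ι t) : ℚ)) ''
                ((topComponent w h).support : Set ((Fin (2 * n) × Fin (2 * n)) →₀ ℕ)))) + 1) *
              ((Nat.log 2 n + (c + 1 + 18)) ^ (6 * (c + 1 + 18)) + 3)) →
        2 ^ ((Nat.log 2 n + c) ^ c) <
          complexity (nestFreeMatchingPoly n ℝ≥0 * h) + complexity h := by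
  constructor
  · intro H k c
    obtain ⟨n₀, hn₀⟩ := H c
    exact ⟨n₀, fun n hn h hh _ _ _ _ _ _ _ _ _ => hn₀ n hn h hh⟩
  · intro H
    refine nnDivisionHard_iff_grandResidualArcsDim.mpr fun k c => ?_
    obtain ⟨n₀, hn₀⟩ := H k c
    obtain ⟨n₁, hn₁⟩ := faceNewtonDim_not_certificate_qp c
    refine ⟨max n₀ n₁, fun n hn h hh hcheap htor hdense hdeep hspread hund hgen hdim => ?_⟩
    by_cases hfib : ∃ b : ℕ, b ≤ n ∧ ∃ ι : Fin (2 * b) × Fin (2 * b) → Fin (2 * n) × Fin (2 * n), Function.Injective ι ∧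
        ∃ (w : Fin (2 * n) × Fin (2 * n) → ℕ) (S : MvPolynomial (Fin (2 * n) × Fin (2 * n)) ℝ≥0),
          topComponent w (nestFreeMatchingPoly n ℝ≥0) = rename ι (nestFreeMatchingPoly b ℝ≥0) * S ∧ S ≠ 0 ∧
          (∀ m ∈ S.support, ∀ e ∈ m.support, e ∉ Set.range ι) ∧
          2 * (Module.finrank ℚ (vectorSpan ℚ ((fun u : (Fin (2 * n) × Fin (2 * n)) →₀ ℕ =>
              fun t : Fin (2 * b) × Fin (2 * b) => (u (ι t) : ℚ)) ''
                ((topComponent w h).support : Set ((Fin (2 * n) × Fin (2 * n)) →₀ ℕ)))) + 1) *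
              ((Nat.log 2 n + (c + 1 + 18)) ^ (6 * (c + 1 + 18)) + 3) ≤ b
    · obtain ⟨b, hb, ι, hι, w, S, hface, hS0, hS, hD⟩ := hfib
      exact hn₁ n (le_trans (le_max_right _ _) hn) b hb ι hι w S hface hS0 hS h hh hD
    · push Not at hfib
      exact hn₀ n (le_trans (le_max_left _ _) hn) h hh hcheap htor hdense hdeep hspread hund hgen hdim
        fun b hb ι hι w S hface hS0 hS => hfib b hb ι hι w S hface hS0 hS

end Summit.ValiantsHypothesis.ValiantsHypothesis.Theorems.FifoMatching.NNDivisionHard.GrandResidualFibreDim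

end
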